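import Summits.AnomalousDissipation.AnomalousDissipation.Theorems.DenseLoudDesignerForces.Negative.Scaling

/-!
# Sketch — crux-ideate round 2, ideator 5, crux `BaireTransfer.DenseLoudDesignerForces` (stmt-AnomalousDissipation-1143)

First lemmas of the idea cards — EVERYTHING BELOW IS PROVED (lean check rc 0, 0 sorry):

* Card I  `lebesgue-not-baire` : `subset_closure_of_ae`, `exists_forall_of_ae`, `DenseLoudDesignerForcesAE`,
  `denseLoudDesignerForces_of_ae`, `exists_loud_all_levels_of_ae`, `denseLoudDesignerForces_iff_balls`,
  `isWindow_of_pos_measure`.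
* Card II `ergodic-budget-selection-closing` : `budget_selection` — PROVED.
* Card III `grashof-cone` : `mem_loudSet_iff_amplitude`, `LoudAt.mono`, `cone_of_dense`, `dense_of_cone`,
  `denseLoudDesignerForces_iff_cone` — ALL PROVED.
-/

noncomputable section

open scoped BigOperators Topology ENNReal InnerProductSpace
open Filter Set MeasureTheory
open Summit.AnomalousDissipation.AnomalousDissipation.Theses.BaireTransfer
open Summit.AnomalousDissipation.AnomalousDissipation.Theorems.DenseLoudDesignerForces.Negative

set_option linter.dupNamespace false
set_option linter.unusedSectionVars false
set_option linter.unusedVariables false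

namespace Summit.AnomalousDissipation.AnomalousDissipation.Cruxes.DenseLoudDesignerForces.Ideate5

/-! ## Card I — Lebesgue, not Baire: a.e.-loudness / ball-ensemble floors imply density -/

section AbstractMeasure

variable {X : Type*} [TopologicalSpace X] [MeasurableSpace X] {μ : Measure X} [μ.IsOpenPosMeasure]

/-- A `μ`-a.e. sub-property of an open set is dense in it, for ANY measure positive on non-empty open sets
(no measurability of `L` needed: `ae` is an outer-measure statement). -/
theorem subset_closure_of_ae (U L : Set X) (hU : IsOpen U) (h : ∀ᵐ x ∂μ, x ∈ U → x ∈ L) :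
    U ⊆ closure L := by
  intro x hx
  rw [mem_closure_iff]
  intro o ho hxo
  by_contra hne
  rw [Set.not_nonempty_iff_eq_empty] at hne
  have hsub : o ∩ U ⊆ {y | ¬ (y ∈ U → y ∈ L)} := by
    intro y hy hyL
    have hy' : y ∈ o ∩ L := ⟨hy.1, hyL hy.2⟩
    rw [hne] at hy'
    exact hy'
  have h0 : μ (o ∩ U) = 0 := measure_mono_null hsub (ae_iff.1 h)
  exact ((ho.inter hU).measure_pos μ ⟨x, hxo, hx⟩).ne' h0

/-- Countably many a.e.-properties on an open non-empty set have a COMMON witness inside it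
(countable intersection of co-null sets is co-null; open non-empty sets have positive measure). -/
theorem exists_forall_of_ae (U : Set X) (hU : IsOpen U) (hne : U.Nonempty) (L : ℕ → Set X)
    (h : ∀ j, ∀ᵐ x ∂μ, x ∈ U → x ∈ L j) : ∃ x ∈ U, ∀ j, x ∈ L j := by
  have h' : ∀ᵐ x ∂μ, ∀ j, x ∈ U → x ∈ L j := ae_all_iff.2 h
  by_contra hno
  push Not at hno
  have hsub : U ⊆ {x | ¬ ∀ j, x ∈ U → x ∈ L j} := by
    intro x hx hall
    obtain ⟨j, hj⟩ := hno x hx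
    exact hj (hall j hx)
  have h0 : μ U = 0 := measure_mono_null hsub (ae_iff.1 h')
  exact (hU.measure_pos μ hne).ne' h0

/-- Positive measure of `V ∩ L` for every open non-empty `V ⊆ U` ("ball-ensemble floor") gives density. -/
theorem subset_closure_of_pos_measure (U L : Set X) (hU : IsOpen U)
    (h : ∀ V : Set X, IsOpen V → V ⊆ U → V.Nonempty → 0 < μ (V ∩ L)) : U ⊆ closure L := by
  intro x hx
  rw [mem_closure_iff]
  intro o ho hxo
  exact nonempty_of_measure_ne_zero (h (o ∩ U) (ho.inter hU) inter_subset_right ⟨x, hxo, hx⟩).ne' |>.mono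
    (fun y hy => ⟨hy.1.1, hy.2⟩)

end AbstractMeasure

/-- The parameter space `P_S = (↥S → ℂ³)` of the crux (a finite-dimensional real normed space; its Lebesgue
measure is `Measure.addHaar`, an `IsOpenPosMeasure` by `inferInstance`). -/
abbrev PS (S : Finset (Fin 3 → ℤ)) : Type := ↥S → EuclideanSpace ℂ (Fin 3)

example (S : Finset (Fin 3 → ℤ)) : (Measure.addHaar : Measure (PS S)).IsOpenPosMeasure := inferInstance

/-- **C⁺_ae (transfer target of Card I).** LEBESGUE-ALMOST-EVERY designer force of the window is loud at every
level: same quantifier prefix as the crux, `U ⊆ closure LOUD_j` replaced by `LOUD_j ⊇ U` Lebesgue-a.e. -/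
def DenseLoudDesignerForcesAE : Prop :=
  ∀ S₀ : Finset (Fin 3 → ℤ), ∃ S : Finset (Fin 3 → ℤ), S₀ ⊆ S ∧ ∃ (E ε : ℝ), 0 < ε ∧
    ∃ U : Set (PS S), IsOpen U ∧ U.Nonempty ∧
      ∀ j : ℕ, ∀ᵐ c ∂(Measure.addHaar : Measure (PS S)), c ∈ U → c ∈ loudSet S E ε j

/-- **Ball form of the crux** (the shape the probabilistic method targets: ONE loud force per open sub-ball
per level). Definitionally equivalent to the crux. -/
def DenseLoudDesignerForcesBalls : Prop :=
  ∀ S₀ : Finset (Fin 3 → ℤ), ∃ S : Finset (Fin 3 → ℤ), S₀ ⊆ S ∧ ∃ (E ε : ℝ), 0 < ε ∧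
    ∃ U : Set (PS S), IsOpen U ∧ U.Nonempty ∧
      ∀ j : ℕ, ∀ V : Set (PS S), IsOpen V → V ⊆ U → V.Nonempty → (V ∩ loudSet S E ε j).Nonempty

/-- **C⁺_floor (ensemble floor).** Every open sub-ball of the window carries a POSITIVE-MEASURE set of loud
forces at every level (any fixed positive fraction would do; positivity is what is used). -/
def BallEnsembleFloor : Prop :=
  ∀ S₀ : Finset (Fin 3 → ℤ), ∃ S : Finset (Fin 3 → ℤ), S₀ ⊆ S ∧ ∃ (E ε : ℝ), 0 < ε ∧
    ∃ U : Set (PS S), IsOpen U ∧ U.Nonempty ∧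
      ∀ j : ℕ, ∀ V : Set (PS S), IsOpen V → V ⊆ U → V.Nonempty →
        0 < (Measure.addHaar : Measure (PS S)) (V ∩ loudSet S E ε j)

/-- Card I, first lemma (a): a.e.-loudness ⇒ the crux. -/
theorem denseLoudDesignerForces_of_ae (h : DenseLoudDesignerForcesAE) : DenseLoudDesignerForces := by
  rw [denseLoudDesignerForces_iff]
  intro S₀
  obtain ⟨S, hS, E, ε, hε, U, hU, hne, hae⟩ := h S₀
  exact ⟨S, hS, E, ε, hε, U, hU, hne, fun j => subset_closure_of_ae U _ hU (hae j)⟩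

/-- Card I, first lemma (b): a.e.-loudness ALONE yields one fixed-degree steady force loud at ALL levels
(the only use the route makes of its Baire target) — no robustness crux (stmt-1144), no Baire. -/
theorem exists_loud_all_levels_of_ae (h : DenseLoudDesignerForcesAE) (S₀ : Finset (Fin 3 → ℤ)) :
    ∃ S : Finset (Fin 3 → ℤ), S₀ ⊆ S ∧ ∃ (E ε : ℝ), 0 < ε ∧ ∃ c : PS S, ∀ j : ℕ, c ∈ loudSet S E ε j := by
  obtain ⟨S, hS, E, ε, hε, U, hU, hne, hae⟩ := h S₀
  obtain ⟨c, -, hc⟩ := exists_forall_of_ae U hU hne (fun j => loudSet S E ε j) hae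
  exact ⟨S, hS, E, ε, hε, c, hc⟩

/-- Card I, first lemma (c): the ball form is the crux (density = meets every open subset). -/
theorem denseLoudDesignerForces_iff_balls : DenseLoudDesignerForces ↔ DenseLoudDesignerForcesBalls := by
  rw [denseLoudDesignerForces_iff]
  unfold DenseLoudDesignerForcesBalls IsWindow
  refine forall_congr' fun S₀ => exists_congr fun S => and_congr_right fun _ => exists_congr fun E =>
    exists_congr fun ε => and_congr_right fun _ => exists_congr fun U => and_congr_right fun hU =>
    and_congr_right fun _ => forall_congr' fun j => ⟨fun h V hV hVU hVne => ?_, fun h c hc => ?_⟩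
  · obtain ⟨c, hc⟩ := hVne
    have := h (hVU hc)
    rw [mem_closure_iff] at this
    exact this V hV hc
  · rw [mem_closure_iff]
    intro o ho hco
    obtain ⟨x, hx⟩ := h (o ∩ U) (ho.inter hU) inter_subset_right ⟨c, hco, hc⟩
    exact ⟨x, hx.1.1, hx.2⟩

/-- Card I, first lemma (d): an ensemble floor on balls ⇒ the crux. -/
theorem denseLoudDesignerForces_of_floor (h : BallEnsembleFloor) : DenseLoudDesignerForces := by
  rw [denseLoudDesignerForces_iff]
  intro S₀
  obtain ⟨S, hS, E, ε, hε, U, hU, hne, hfl⟩ := h S₀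
  exact ⟨S, hS, E, ε, hε, U, hU, hne, fun j => subset_closure_of_pos_measure U _ hU (hfl j)⟩

/-! ## Card II — loud ergodic component, then closing: the budget-selection lemma -/

/-- **BUDGET SELECTION** (first lemma of Card II; provable now: Markov + Cauchy–Schwarz + splitting).
Abstract form over the ergodic decomposition `P` of a loud invariant measure: `D ω`, `En ω` are the mean
dissipation / mean energy of the component `ω`; the POWER IDENTITY per component gives `D ≤ F·√En`
(`F = ‖f_c‖_{L²}`, cf. `meanDissipation_sq_le`); the loud trajectory gives `∫ D ≥ ε`, `∫ En ≤ E`.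
Conclusion: components with energy `≤ 16 F² E² / ε²` AND dissipation `≥ ε/2` have probability
`≥ ε²/(16 F² E) > 0` — a loud ERGODIC measure exists with budgets inflated by a `j`-INDEPENDENT factor. -/
theorem budget_selection {Ω : Type*} [MeasurableSpace Ω] (P : Measure Ω) [IsProbabilityMeasure P]
    {D En : Ω → ℝ} (hDm : Measurable D) (hEm : Measurable En) (hD0 : ∀ ω, 0 ≤ D ω) (hE0 : ∀ ω, 0 ≤ En ω)
    {F E ε : ℝ} (hF : 0 < F) (hE : 0 < E) (hε : 0 < ε)
    (hpow : ∀ ω, D ω ≤ F * Real.sqrt (En ω)) (hDi : Integrable D P) (hEi : Integrable En P)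
    (hD : ε ≤ ∫ ω, D ω ∂P) (hEn : ∫ ω, En ω ∂P ≤ E) :
    ENNReal.ofReal (ε ^ 2 / (16 * F ^ 2 * E)) ≤ P {ω | En ω ≤ 16 * F ^ 2 * E ^ 2 / ε ^ 2 ∧ ε / 2 ≤ D ω} := by
  set K : ℝ := 4 * F * E / ε with hK
  have hKpos : 0 < K := by positivity
  have hK2 : K ^ 2 = 16 * F ^ 2 * E ^ 2 / ε ^ 2 := by rw [hK]; field_simp; ring
  have hFK : F / K = ε / (4 * E) := by rw [hK]; field_simp
  set B : Set Ω := {ω | En ω ≤ 16 * F ^ 2 * E ^ 2 / ε ^ 2 ∧ ε / 2 ≤ D ω} with hB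
  have hBm : MeasurableSet B :=
    (hEm measurableSet_Iic).inter (hDm measurableSet_Ici)
  -- pointwise domination
  have hind0 : ∀ ω, 0 ≤ B.indicator (fun _ => (1:ℝ)) ω := fun ω =>
    Set.indicator_nonneg (fun _ _ => zero_le_one) ω
  have hpt : ∀ ω, D ω ≤ ε / (4 * E) * En ω + F * K * B.indicator (fun _ => (1:ℝ)) ω + ε / 2 := by
    intro ω
    have h4 : 0 ≤ ε / (4 * E) * En ω := mul_nonneg (by positivity) (hE0 ω)
    have h3 : 0 ≤ F * K * B.indicator (fun _ => (1:ℝ)) ω :=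
      mul_nonneg (mul_nonneg hF.le hKpos.le) (hind0 ω)
    by_cases hA : K ^ 2 < En ω
    · have h1 : K ≤ Real.sqrt (En ω) := by
        rw [← Real.sqrt_sq hKpos.le]; exact Real.sqrt_le_sqrt hA.le
      have hs : Real.sqrt (En ω) * K ≤ En ω := by
        calc Real.sqrt (En ω) * K ≤ Real.sqrt (En ω) * Real.sqrt (En ω) := by
              gcongr
          _ = En ω := Real.mul_self_sqrt (hE0 ω)
      have h2 : F * Real.sqrt (En ω) ≤ ε / (4 * E) * En ω := by
        calc F * Real.sqrt (En ω) = (F / K) * (Real.sqrt (En ω) * K) := by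
              field_simp
          _ ≤ (F / K) * En ω := by gcongr
          _ = ε / (4 * E) * En ω := by rw [hFK]
      linarith [hpow ω]
    · push Not at hA
      have h1 : Real.sqrt (En ω) ≤ K := by
        calc Real.sqrt (En ω) ≤ Real.sqrt (K ^ 2) := Real.sqrt_le_sqrt hA
          _ = K := Real.sqrt_sq hKpos.le
      by_cases hD2 : ε / 2 ≤ D ω
      · have hmem : ω ∈ B := ⟨by rw [← hK2]; exact hA, hD2⟩
        have hind : B.indicator (fun _ => (1:ℝ)) ω = 1 := Set.indicator_of_mem hmem _
        have h2 : F * Real.sqrt (En ω) ≤ F * K := by gcongr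
        rw [hind]; linarith [hpow ω]
      · push Not at hD2
        linarith
  -- integrate the domination
  have hIi : Integrable (fun ω => B.indicator (fun _ => (1:ℝ)) ω) P :=
    (integrable_const (1:ℝ)).indicator hBm
  have hrhs : Integrable (fun ω => ε / (4 * E) * En ω + F * K * B.indicator (fun _ => (1:ℝ)) ω + ε / 2) P :=
    ((hEi.const_mul _).add (hIi.const_mul _)).add (integrable_const _)
  have hint : ∫ ω, D ω ∂P ≤ ε / (4 * E) * (∫ ω, En ω ∂P) + F * K * (P B).toReal + ε / 2 := by
    have step := integral_mono hDi hrhs hpt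
    have h12 : Integrable (fun ω => ε / (4 * E) * En ω + F * K * B.indicator (fun _ => (1:ℝ)) ω) P :=
      (hEi.const_mul _).add (hIi.const_mul _)
    have i1 : ∫ ω, (ε / (4 * E) * En ω + F * K * B.indicator (fun _ => (1:ℝ)) ω + ε / 2) ∂P
        = (∫ ω, (ε / (4 * E) * En ω + F * K * B.indicator (fun _ => (1:ℝ)) ω) ∂P) + ∫ _ω, ε / 2 ∂P :=
      integral_add h12 (integrable_const _)
    have i2 : ∫ ω, (ε / (4 * E) * En ω + F * K * B.indicator (fun _ => (1:ℝ)) ω) ∂P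
        = (∫ ω, ε / (4 * E) * En ω ∂P) + ∫ ω, F * K * B.indicator (fun _ => (1:ℝ)) ω ∂P :=
      integral_add (hEi.const_mul _) (hIi.const_mul _)
    have i3 : ∫ ω, ε / (4 * E) * En ω ∂P = ε / (4 * E) * ∫ ω, En ω ∂P := integral_const_mul _ _
    have i4 : ∫ ω, F * K * B.indicator (fun _ => (1:ℝ)) ω ∂P = F * K * (P B).toReal := by
      rw [integral_const_mul]
      congr 1
      rw [integral_indicator hBm, setIntegral_const, smul_eq_mul, mul_one]
      rfl
    have i5 : ∫ _ω, ε / 2 ∂P = ε / 2 := by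
      rw [integral_const]; simp
    linarith [i1, i2, i3, i4, i5, step]
  have hb1 : ε / (4 * E) * (∫ ω, En ω ∂P) ≤ ε / 4 := by
    calc ε / (4 * E) * (∫ ω, En ω ∂P) ≤ ε / (4 * E) * E := by gcongr
      _ = ε / 4 := by field_simp
  have hPB : ε ^ 2 / (16 * F ^ 2 * E) ≤ (P B).toReal := by
    have hFKpos : 0 < F * K := mul_pos hF hKpos
    have h5 : ε / 4 ≤ F * K * (P B).toReal := by linarith
    have h6 : ε / 4 / (F * K) ≤ (P B).toReal := by
      rw [div_le_iff₀ hFKpos]; linarith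
    have e2 : ε / 4 / (F * K) = ε ^ 2 / (16 * F ^ 2 * E) := by rw [hK]; field_simp; ring
    linarith [e2 ▸ h6]
  exact (ENNReal.ofReal_le_iff_le_toReal (measure_ne_top P B)).2 hPB

/-! ## Card III — Grashof cone: the crux on force DIRECTIONS at viscosity one -/

/-- Pointwise amplitude form (signature; from `mem_loudSet_iff_unit_viscosity` with `A = ‖c‖/ν²`):
for `c ≠ 0`, `c ∈ LOUD_j(S,E,ε)` iff its DIRECTION `‖c‖⁻¹c` carries, at some viscous-unit amplitude
`A > ‖c‖(j+1)²`, a periodic orbit of NS at viscosity ONE with the K41/Grashof budgets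
energy `≤ (E/‖c‖)·A`, dissipation `≥ (ε/‖c‖^{3/2})·A^{3/2}`. -/
theorem mem_loudSet_iff_amplitude {S : Finset (Fin 3 → ℤ)} {E ε : ℝ} {j : ℕ} {c : PS S} (hc : c ≠ 0) :
    c ∈ loudSet S E ε j ↔
      ∃ A : ℝ, ‖c‖ * ((j : ℝ) + 1) ^ 2 < A ∧
        LoudAt S 1 (E / ‖c‖ * A) (ε / (‖c‖ * Real.sqrt ‖c‖) * (A * Real.sqrt A)) (A • (‖c‖⁻¹ • c)) := by
  have hcn : 0 < ‖c‖ := norm_pos_iff.2 hc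
  set s : ℝ := Real.sqrt ‖c‖ with hsdef
  have hspos : 0 < s := Real.sqrt_pos.2 hcn
  have hs2 : ‖c‖ = s ^ 2 := (Real.sq_sqrt hcn.le).symm
  rw [mem_loudSet_iff_unit_viscosity]
  constructor
  · rintro ⟨ν, hν, hνj, hL⟩
    have hj1 : (0:ℝ) < (j:ℝ) + 1 := by positivity
    refine ⟨‖c‖ / ν ^ 2, ?_, ?_⟩
    · rw [lt_div_iff₀ (by positivity)]
      have h1 : ν * ((j:ℝ) + 1) < 1 := by
        rwa [lt_div_iff₀ hj1] at hνj
      have h2 : 0 < ν * ((j:ℝ) + 1) := by positivity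
      have h3 : (ν * ((j:ℝ) + 1)) ^ 2 < 1 := by nlinarith
      have h4 : ‖c‖ * ((j:ℝ) + 1) ^ 2 * ν ^ 2 = ‖c‖ * (ν * ((j:ℝ) + 1)) ^ 2 := by ring
      rw [h4]
      nlinarith
    · have hν0 : ν ≠ 0 := hν.ne'
      have hsA : Real.sqrt (‖c‖ / ν ^ 2) = s / ν := by
        rw [Real.sqrt_div (norm_nonneg _), Real.sqrt_sq hν.le]
      have e1 : E / ‖c‖ * (‖c‖ / ν ^ 2) = E / ν ^ 2 := by
        field_simp
      have e2 : ε / (‖c‖ * s) * (‖c‖ / ν ^ 2 * Real.sqrt (‖c‖ / ν ^ 2)) = ε / ν ^ 3 := by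
        rw [hsA, hs2]
        field_simp
      have e3 : (‖c‖ / ν ^ 2) • (‖c‖⁻¹ • c) = (ν ^ 2)⁻¹ • c := by
        rw [smul_smul]
        congr 1
        field_simp
      rw [e1, e2, e3]
      exact hL
  · rintro ⟨A, hA, hL⟩
    have hA0 : 0 ≤ ‖c‖ * ((j : ℝ) + 1) ^ 2 := by positivity
    have hApos : 0 < A := lt_of_le_of_lt hA0 hA
    set a : ℝ := Real.sqrt A with hadef
    have hapos : 0 < a := Real.sqrt_pos.2 hApos
    have ha2 : A = a ^ 2 := (Real.sq_sqrt hApos.le).symm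
    set ν : ℝ := s / a with hνdef
    have hνpos : 0 < ν := div_pos hspos hapos
    have hν2 : ν ^ 2 = ‖c‖ / A := by
      rw [hνdef, div_pow, hs2, ha2]
    refine ⟨ν, hνpos, ?_, ?_⟩
    · have hj1 : (0:ℝ) < (j:ℝ) + 1 := by positivity
      rw [lt_div_iff₀ hj1]
      have h1 : (ν * ((j:ℝ) + 1)) ^ 2 < 1 := by
        rw [mul_pow, hν2, div_mul_eq_mul_div, div_lt_one hApos]
        exact hA
      have h2 : 0 < ν * ((j:ℝ) + 1) := by positivity
      nlinarith
    · have hν0 : ν ≠ 0 := hνpos.ne'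
      have ha0 : a ≠ 0 := hapos.ne'
      have hs0 : s ≠ 0 := hspos.ne'
      have e1 : E / ν ^ 2 = E / ‖c‖ * A := by
        rw [hν2]
        field_simp
      have e2 : ε / ν ^ 3 = ε / (‖c‖ * s) * (A * a) := by
        rw [hνdef, hs2, ha2]
        field_simp
      have e3 : (ν ^ 2)⁻¹ • c = A • (‖c‖⁻¹ • c) := by
        rw [hν2, smul_smul]
        congr 1
        field_simp
      rw [e1, e2, e3]
      exact hL

/-- Monotonicity of `LoudAt` in the budgets. -/
theorem LoudAt.mono {S : Finset (Fin 3 → ℤ)} {ν E E' ε ε' : ℝ} {c : PS S} (hE : E ≤ E') (hε : ε' ≤ ε)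
    (h : LoudAt S ν E ε c) : LoudAt S ν E' ε' c := by
  obtain ⟨τ, u, p, hτ, hsol, hper, hEu, hεu⟩ := h
  exact ⟨τ, u, p, hτ, hsol, hper, hEu.trans hE, hε.trans hεu⟩

/-- **C⁺_cone (transfer target of Card III).** Infinitely-often K41-efficient force DIRECTIONS are dense in
an open cone: viscosity fixed to one, no levels, budgets in Grashof scaling with FIXED constants. -/
def DenseIOEfficientDirections : Prop :=
  ∀ S₀ : Finset (Fin 3 → ℤ), ∃ S : Finset (Fin 3 → ℤ), S₀ ⊆ S ∧ ∃ (C₁ C₂ : ℝ), 0 < C₂ ∧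
    ∃ Ω : Set (PS S), IsOpen Ω ∧ (Ω ∩ Metric.sphere 0 1).Nonempty ∧
      ∀ A₀ : ℝ, Ω ∩ Metric.sphere 0 1 ⊆
        closure {d : PS S | d ∈ Metric.sphere 0 1 ∧ ∃ A : ℝ, A₀ < A ∧ LoudAt S 1 (C₁ * A) (C₂ * (A * Real.sqrt A)) (A • d)}

/-- Normalisation lands on the unit sphere. -/
theorem norm_inv_smul_mem_sphere {S : Finset (Fin 3 → ℤ)} {c : PS S} (hc : c ≠ 0) :
    ‖c‖⁻¹ • c ∈ Metric.sphere (0 : PS S) 1 := by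
  rw [mem_sphere_zero_iff_norm, norm_smul, norm_inv, norm_norm, inv_mul_cancel₀ (norm_ne_zero_iff.2 hc)]

/-- Card III, transfer ⇒ : a window yields a dense cone of i.o.-efficient directions (polar rectangle over
`c₀ ∈ U`, `C₁ := 2E/‖c₀‖`, `C₂ := ε/(2‖c₀‖√(2‖c₀‖))`, `Ω := {d | ‖c₀‖ • d ∈ U}`). -/
theorem cone_of_dense (h : DenseLoudDesignerForces) : DenseIOEfficientDirections := by
  intro S₀
  obtain ⟨S, hS, E, ε, hε, U, hW⟩ := (denseLoudDesignerForces_iff.1 h) S₀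
  have hU : IsOpen U := hW.1
  obtain ⟨c₀, hc₀⟩ := hW.2.1
  have hc₀0 : c₀ ≠ 0 := fun h0 => zero_not_mem_window hε hW (h0 ▸ hc₀)
  set r₀ : ℝ := ‖c₀‖ with hr₀
  have hr₀pos : 0 < r₀ := norm_pos_iff.2 hc₀0
  have hEpos : 0 < E := energy_pos_of_window hε hW
  refine ⟨S, hS, 2 * E / r₀, ε / (2 * r₀ * Real.sqrt (2 * r₀)), by positivity, ?_⟩
  -- the cone: directions d with r₀ • d ∈ U
  refine ⟨{d : PS S | r₀ • d ∈ U}, ?_, ?_, ?_⟩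
  · exact hU.preimage (continuous_const_smul r₀)
  · refine ⟨‖c₀‖⁻¹ • c₀, ?_, norm_inv_smul_mem_sphere hc₀0⟩
    show r₀ • (‖c₀‖⁻¹ • c₀) ∈ U
    rw [smul_smul, hr₀, mul_inv_cancel₀ (norm_ne_zero_iff.2 hc₀0), one_smul]
    exact hc₀
  · intro A₀ d ⟨hdU, hds⟩
    rw [mem_sphere_zero_iff_norm] at hds
    rw [Metric.mem_closure_iff]
    intro η hη
    -- the point c := r₀ • d ∈ U, a ball around it inside U
    set c : PS S := r₀ • d with hcdef
    have hcU : c ∈ U := hdU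
    have hcn : ‖c‖ = r₀ := by rw [hcdef, norm_smul, Real.norm_of_nonneg hr₀pos.le, hds, mul_one]
    obtain ⟨ρ, hρ, hball⟩ := Metric.isOpen_iff.1 hU c hcU
    -- a level deep enough that amplitudes exceed A₀
    obtain ⟨j, hj⟩ : ∃ j : ℕ, A₀ < r₀ / 2 * ((j : ℝ) + 1) ^ 2 := by
      obtain ⟨j, hj⟩ := exists_nat_gt (A₀ / (r₀ / 2))
      refine ⟨j, ?_⟩
      have h1 : A₀ / (r₀ / 2) < ((j : ℝ) + 1) ^ 2 := by nlinarith [hj, sq_nonneg ((j:ℝ))]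
      rwa [div_lt_iff₀ (by positivity), mul_comm] at h1
    -- a loud force δ-close to c
    set δ : ℝ := min (r₀ / 2) (η * r₀ / 4) with hδ
    have hδpos : 0 < δ := by positivity
    have hδ1 : δ ≤ r₀ / 2 := min_le_left _ _
    have hδ2 : δ ≤ η * r₀ / 4 := min_le_right _ _
    have hcl : c ∈ closure (loudSet S E ε j) := hW.2.2 j hcU
    rw [Metric.mem_closure_iff] at hcl
    obtain ⟨c', hc'L, hcc'⟩ := hcl δ hδpos
    -- norms of c'
    have hnorm_sub : |‖c'‖ - r₀| < δ := by
      rw [← hcn]; rw [dist_eq_norm] at hcc'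
      calc |‖c'‖ - ‖c‖| ≤ ‖c' - c‖ := abs_norm_sub_norm_le c' c
        _ = ‖c - c'‖ := norm_sub_rev c' c
        _ < δ := hcc'
    have hlow : r₀ / 2 ≤ ‖c'‖ := by
      have := (abs_lt.1 hnorm_sub).1; linarith
    have hupp : ‖c'‖ ≤ 2 * r₀ := by
      have := (abs_lt.1 hnorm_sub).2; linarith
    have hc'pos : 0 < ‖c'‖ := lt_of_lt_of_le (by positivity) hlow
    have hc'0 : c' ≠ 0 := norm_pos_iff.1 hc'pos
    -- amplitude form of loudness of c'
    obtain ⟨A, hA, hL⟩ := (mem_loudSet_iff_amplitude hc'0).1 hc'L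
    refine ⟨‖c'‖⁻¹ • c', ⟨norm_inv_smul_mem_sphere hc'0, A, ?_, ?_⟩, ?_⟩
    · -- A₀ < A
      calc A₀ < r₀ / 2 * ((j : ℝ) + 1) ^ 2 := hj
        _ ≤ ‖c'‖ * ((j : ℝ) + 1) ^ 2 := by gcongr
        _ < A := hA
    · -- budgets by monotonicity
      have hApos : 0 < A := lt_of_le_of_lt (by positivity) hA
      refine LoudAt.mono ?_ ?_ hL
      · -- E/‖c'‖ * A ≤ 2E/r₀ * A
        have : E / ‖c'‖ ≤ 2 * E / r₀ := by
          rw [div_le_div_iff₀ hc'pos hr₀pos]; nlinarith [hlow, hEpos.le]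
        exact mul_le_mul_of_nonneg_right this hApos.le
      · -- ε/(2r₀√(2r₀)) * (A√A) ≤ ε/(‖c'‖√‖c'‖) * (A√A)
        have hs : Real.sqrt ‖c'‖ ≤ Real.sqrt (2 * r₀) := Real.sqrt_le_sqrt hupp
        have hspos : 0 < Real.sqrt ‖c'‖ := Real.sqrt_pos.2 hc'pos
        have : ε / (2 * r₀ * Real.sqrt (2 * r₀)) ≤ ε / (‖c'‖ * Real.sqrt ‖c'‖) := by
          apply div_le_div_of_nonneg_left hε.le (by positivity)
          exact mul_le_mul hupp hs hspos.le (by positivity)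
        exact mul_le_mul_of_nonneg_right this (by positivity)
    · -- distance of directions
      rw [dist_eq_norm]
      have e1 : d = r₀⁻¹ • c := by
        rw [hcdef, smul_smul, inv_mul_cancel₀ hr₀pos.ne', one_smul]
      have hcc'n : ‖c - c'‖ < δ := by rwa [dist_eq_norm] at hcc'
      calc ‖d - ‖c'‖⁻¹ • c'‖ = ‖(r₀⁻¹ • c - r₀⁻¹ • c') + (r₀⁻¹ • c' - ‖c'‖⁻¹ • c')‖ := by
            rw [e1]; congr 1; abel
        _ ≤ ‖r₀⁻¹ • c - r₀⁻¹ • c'‖ + ‖r₀⁻¹ • c' - ‖c'‖⁻¹ • c'‖ := norm_add_le _ _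
        _ = r₀⁻¹ * ‖c - c'‖ + |r₀⁻¹ - ‖c'‖⁻¹| * ‖c'‖ := by
            rw [← smul_sub, norm_smul, Real.norm_of_nonneg (inv_nonneg.2 hr₀pos.le), ← sub_smul, norm_smul,
              Real.norm_eq_abs]
        _ = r₀⁻¹ * ‖c - c'‖ + r₀⁻¹ * |‖c'‖ - r₀| := by
            congr 1
            rw [show r₀⁻¹ - ‖c'‖⁻¹ = (‖c'‖ - r₀) * (r₀⁻¹ * ‖c'‖⁻¹) by field_simp]
            rw [abs_mul, abs_of_pos (by positivity : 0 < r₀⁻¹ * ‖c'‖⁻¹)]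
            field_simp
        _ < r₀⁻¹ * δ + r₀⁻¹ * δ := by gcongr
        _ ≤ η := by
            rw [← mul_add, inv_mul_le_iff₀ hr₀pos]; linarith

/-- Card III, transfer ⇐ : a dense cone of i.o.-efficient directions yields the window
`U := {1 < ‖c‖ < 2} ∩ {‖c‖⁻¹c ∈ Ω}` with budgets `(2C₁, C₂)`. -/
theorem dense_of_cone (h : DenseIOEfficientDirections) : DenseLoudDesignerForces := by
  rw [denseLoudDesignerForces_iff]
  intro S₀
  obtain ⟨S, hS, C₁, C₂, hC₂, Ω, hΩ, ⟨d₀, hd₀Ω, hd₀s⟩, hcone⟩ := h S₀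
  -- the window: the shell 1 < ‖c‖ < 2 over the cone
  set V : Set (PS S) := {c | 1 < ‖c‖ ∧ ‖c‖ < 2} with hV
  set g : PS S → PS S := fun c => ‖c‖⁻¹ • c with hg
  have hVo : IsOpen V := (isOpen_lt continuous_const continuous_norm).inter (isOpen_lt continuous_norm continuous_const)
  have hgV : ContinuousOn g V := by
    refine ContinuousOn.smul (ContinuousOn.inv₀ continuous_norm.continuousOn ?_) continuousOn_id
    intro c hc; exact (lt_trans zero_lt_one hc.1).ne'
  refine ⟨S, hS, 2 * C₁, C₂, hC₂, V ∩ g ⁻¹' Ω, hgV.isOpen_inter_preimage hVo hΩ, ?_, ?_⟩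
  · -- non-empty: (3/2) • d₀
    rw [mem_sphere_zero_iff_norm] at hd₀s
    have hn : ‖((3:ℝ) / 2) • d₀‖ = 3 / 2 := by rw [norm_smul, hd₀s, mul_one]; norm_num
    refine ⟨((3:ℝ) / 2) • d₀, ⟨by rw [hn]; norm_num, by rw [hn]; norm_num⟩, ?_⟩
    show ‖((3:ℝ) / 2) • d₀‖⁻¹ • (((3:ℝ) / 2) • d₀) ∈ Ω
    rw [hn, smul_smul]; norm_num; exact hd₀Ω
  · intro j c ⟨⟨hc1, hc2⟩, hcΩ⟩
    have hcpos : 0 < ‖c‖ := lt_trans zero_lt_one hc1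
    have hc0 : c ≠ 0 := norm_pos_iff.1 hcpos
    have hgc : g c ∈ Ω ∩ Metric.sphere 0 1 := ⟨hcΩ, norm_inv_smul_mem_sphere hc0⟩
    rw [Metric.mem_closure_iff]
    intro η hη
    have hcl := hcone (2 * ((j : ℝ) + 1) ^ 2) hgc
    rw [Metric.mem_closure_iff] at hcl
    obtain ⟨d', ⟨hd's, A, hA, hL⟩, hdd'⟩ := hcl (η / 2) (by positivity)
    rw [mem_sphere_zero_iff_norm] at hd's
    -- the loud force near c
    refine ⟨‖c‖ • d', ?_, ?_⟩
    · have hn' : ‖‖c‖ • d'‖ = ‖c‖ := by rw [norm_smul, norm_norm, hd's, mul_one]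
      have hne : ‖c‖ • d' ≠ 0 := by rw [← norm_pos_iff, hn']; exact hcpos
      rw [mem_loudSet_iff_amplitude hne, hn']
      have hApos : 0 < A := lt_of_le_of_lt (by positivity) hA
      refine ⟨A, ?_, ?_⟩
      · calc ‖c‖ * ((j : ℝ) + 1) ^ 2 ≤ 2 * ((j : ℝ) + 1) ^ 2 := by gcongr
          _ < A := hA
      · have e : ‖c‖⁻¹ • (‖c‖ • d') = d' := by rw [smul_smul, inv_mul_cancel₀ hcpos.ne', one_smul]
        rw [e]
        refine LoudAt.mono ?_ ?_ hL
        · -- C₁ A ≤ 2C₁/‖c‖ * A  (for C₁ < 0 the hypothesis hL is vacuous: mean energy is non-negative)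
          by_cases hC : 0 ≤ C₁
          · apply mul_le_mul_of_nonneg_right _ hApos.le
            rw [le_div_iff₀ hcpos]
            have := mul_le_mul_of_nonneg_left hc2.le hC
            linarith
          · exfalso
            push Not at hC
            obtain ⟨τ, u, p, hτ, -, hper, hEu, -⟩ := hL
            have h0 := meanEnergy_nonneg' hper hτ
            have hneg : C₁ * A < 0 := mul_neg_of_neg_of_pos hC hApos
            linarith
        · -- C₂/(‖c‖√‖c‖) (A√A) ≤ C₂ (A√A)
          apply mul_le_mul_of_nonneg_right _ (by positivity)
          rw [div_le_iff₀ (by positivity)]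
          have h1 : 1 ≤ Real.sqrt ‖c‖ := by rw [← Real.sqrt_one]; exact Real.sqrt_le_sqrt hc1.le
          have h2 : 1 ≤ ‖c‖ * Real.sqrt ‖c‖ := one_le_mul_of_one_le_of_one_le hc1.le h1
          have := mul_le_mul_of_nonneg_left h2 hC₂.le
          linarith
    · rw [dist_eq_norm]
      have e1 : c = ‖c‖ • g c := by
        show c = ‖c‖ • (‖c‖⁻¹ • c); rw [smul_smul, mul_inv_cancel₀ hcpos.ne', one_smul]
      calc ‖c - ‖c‖ • d'‖ = ‖‖c‖ • (g c - d')‖ := by rw [smul_sub, ← e1]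
        _ = ‖c‖ * ‖g c - d'‖ := by rw [norm_smul, norm_norm]
        _ < 2 * (η / 2) := by
            apply mul_lt_mul'' hc2 _ hcpos.le (norm_nonneg _)
            rwa [← dist_eq_norm]
        _ = η := by ring

/-- **Card III, transfer (PROVED).** The Grashof-cone form is EQUIVALENT to the crux. -/
theorem denseLoudDesignerForces_iff_cone : DenseLoudDesignerForces ↔ DenseIOEfficientDirections :=
  ⟨cone_of_dense, dense_of_cone⟩

end Summit.AnomalousDissipation.AnomalousDissipation.Cruxes.DenseLoudDesignerForces.Ideate5

end
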